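import Summits.CriticalPhenomena.PercolationContinuityZ3.Theorems.PercNearOneGluingNoHeavyPcintKernZ6B4Check1
import Summits.CriticalPhenomena.PercolationContinuityZ3.Theorems.PercNearOneGluingNoHeavyPcintKernZ6B4Check2
import Summits.CriticalPhenomena.PercolationContinuityZ3.Theorems.PercNearOneGluingNoHeavyPcintKernZ6B4Check3
import Summits.CriticalPhenomena.PercolationContinuityZ3.Theorems.PercNearOneGluingNoHeavyPcintKernZ6B4Check4
import HarnessLib

/-!
# PCINT lane: `p_c^bond(ℤ⁶) ≥ 0.0923` (kernel-checked B3r window certificate, memory 4 (3-step windows, 1728 codes); printed best lower bound 0.09183 (Noonan 1998)).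

Cell `prim-pcint`, seat `prim-pcint-2` (gen 2); memo `run/shared/lean/prim/pcint/INTERVAL-PLAN.md` §14.  Does NOT build on p205010.
Assembles the kernel-checked chunks (`…KernZ6B4Check1..4`) and applies the generic certificate theorem
`WinK.le_criticalProb_of_checkB` (`…PcintWinKernelCert`).  No external certificate, no
`native_decide`; axioms standard.  (The lane's two-implementation certificates reach further at larger memory; this is the kernel-only row.)
-/

namespace Summit.CriticalPhenomena.PercolationContinuityZ3.Theorems.Pcint

open Literature.Probability.Percolation Literature.Probability.LatticeModels Z6B4

/-- All `1728` coded Collatz–Wielandt rows check. [folklore] -/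
theorem Z6B4.chkAll : WinK.allRange (WinK.rowOKB 6 2 923 10043 9958 99999 tbl 90539) 0 1728 = true :=
  chk_split (chk_split (chk_split chkFile_1 chkFile_2) chkFile_3) chkFile_4

/-- **`p_c^bond(ℤ⁶) ≥ 0.0923`** (kernel-checked B3r window certificate, memory 4 (3-step windows, 1728 codes); printed best lower bound 0.09183 (Noonan 1998)). [folklore] -/
theorem criticalProb_Z6_ge_00923 : (0.0923 : ℝ) ≤ criticalProb (zdGraph 6) 0 := by
  have h := WinK.le_criticalProb_of_checkB (d := 6) (m := 2) (pn := 923) (R := 10043) (S := 9958) (lamN := 99999)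
      (tbl := tbl) (dflt := 90539) (vlo := 90539) (vhi := 100000) (by norm_num) (by norm_num) (by norm_num) (by norm_num)
      (by norm_num) (by norm_num) (by norm_num) (by norm_num) tbl_bounds (by norm_num) (by norm_num) chkAll
  have e : ((923 : ℕ) : ℝ) / 10 ^ 4 = 0.0923 := by norm_num
  rw [e] at h
  exact h

end Summit.CriticalPhenomena.PercolationContinuityZ3.Theorems.Pcint
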